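import Summits.BirchSwinnertonDyer.Rank1Residual.Supersingular.SprungChromaticNonvanishing
import Summits.BirchSwinnertonDyer.Rank1Residual.Supersingular.SharpFlatNonvanishing
import Literature.NumberTheory.EllipticCurves.Sprung2017.SharpFlatPAdicLFunctionProofs
import HarnessLib

/-!
# Kernel edges of the obligation node `SprungChromaticNonvanishing` (Sprung 2012 Conj. 6.15, `η = 1`,
# odd `p`): its OPEN content is exactly the positive-analytic-rank case; chromatic and class-X8 forms

Companion of the pure conjecture leaf `Supersingular/SprungChromaticNonvanishing.lean` (cell `bsd-littype`,
seat `bsd-littype-11` g2). THEOREMS ONLY, each a one-line assembly of tree theorems; nothing about any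
curve is asserted and the node is NOT proved. What the edges display:

* `sprungChromaticNonvanishing_iff_posAnalyticRank` — the node is EQUIVALENT to its restriction to
  `ord_{s=1} L(E, s) ≠ 0`: in analytic rank `0` both colours are non-zero by the constant-term table
  (Sprung 2012 Prop. 6.14, second sentence = tree theorem
  `Supersingular.sharp_ne_zero_and_flat_ne_zero_of_analyticRank_eq_zero`). So the OPEN content is
  "`L♯ ≠ 0 ∧ L♭ ≠ 0` at an odd good supersingular prime when `L(E, 1) = 0`".
* `SprungChromaticNonvanishing.chromaticL_ne_zero` — chromatic form: granted the node, EVERY colour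
  `L^•` of every Sprung pair is non-zero, so Sprung's Thm. 7.14 / 7.16 / Main Conj. 7.21 ("choose
  `∗ ∈ {♯, ♭}` so that `L∗ ≠ 0`") are available for both colours.
* `SprungChromaticNonvanishing.classX8` — on class X8 (`p = 3` good supersingular, `a_3 = ±3`, the
  only `a_p ≠ 0` supersingular case over `ℚ`; `Rank1Residual.ClassX8`) in ANY analytic rank.
* `SprungChromaticNonvanishing.exists_pair_both_ne_zero` — with Sprung's existence theorem
  (`thm112_exists_isSprungPair_holds`, PROVED in the tree) the node yields a pair with both members
  non-zero.

References: [Sprung2012] Prop. 6.14, Conj. 6.15 (p. 1498), Thm. 7.14/7.16, Main Conj. 7.21;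
[Sprung2017] Thm. 1.12, Conj. 4.12; [Sprung2024] p. 8 ("Zero-function avoidance"), Lemma 3.11.
-/

set_option autoImplicit false

noncomputable section

open scoped MatrixGroups ModularForm

open CongruenceSubgroup WeierstrassCurve Literature.NumberTheory.EllipticCurves
  Literature.NumberTheory.EllipticCurves.ModularForms
  Literature.NumberTheory.EllipticCurves.Rank1Residual
  Literature.NumberTheory.EllipticCurves.Sprung2017

namespace Summit.BirchSwinnertonDyer.Rank1Residual.Supersingular

/-- **The open content of Sprung's Conj. 6.15 (`η = 1`, odd `p`) is the positive-analytic-rank case.**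
The node `SprungChromaticNonvanishing` is equivalent to the same statement with the extra hypothesis
`W.analyticRank ≠ 0`: at `r_an(E) = 0` both colours are non-zero by Prop. 6.14 (second sentence), the
tree theorem `sharp_ne_zero_and_flat_ne_zero_of_analyticRank_eq_zero`.
[cite: Sprung2012, Prop. 6.14 and Conj. 6.15 (p. 1498)] -/
theorem sprungChromaticNonvanishing_iff_posAnalyticRank :
    SprungChromaticNonvanishing ↔
      ∀ (W : WeierstrassCurve ℚ) [W.IsElliptic] [W.IsGloballyMinimal] (p : ℕ) [Fact p.Prime],
        p ≠ 2 → GoodSS W p → W.analyticRank ≠ 0 →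
        ∀ (N : ℕ) [NeZero N] (f : CuspForm (Gamma0 N) 2), IsNewformOf W f →
        ∀ (Lsharp Lflat : IwasawaAlgebra p), IsSprungPair f p (W.frobeniusTrace p) Lsharp Lflat →
          Lsharp ≠ 0 ∧ Lflat ≠ 0 := by
  constructor
  · intro h W _ _ p _ hp2 hG _ N _ f hf Lsharp Lflat hSP
    exact h W p hp2 hG N f hf Lsharp Lflat hSP
  · intro h W _ _ p _ hp2 hG N _ f hf Lsharp Lflat hSP
    by_cases h0 : W.analyticRank = 0
    · exact sharp_ne_zero_and_flat_ne_zero_of_analyticRank_eq_zero hp2 hf hG.1 hG.2 hSP h0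
    · exact h W p hp2 hG h0 N f hf Lsharp Lflat hSP

/-- **Chromatic form**: granted the node, every colour `L^•` of every Sprung pair of the newform of
`E` at an odd good supersingular prime is non-zero — the hypothesis "`∗` so that `L∗_p(E, X) ≠ 0`" of
Sprung 2012 Thm. 7.14 / 7.16 / Main Conj. 7.21 then holds for both colours.
[cite: Sprung2012, Conj. 6.15 (p. 1498) and Main Conj. 7.21 (p. 1505)] -/
theorem SprungChromaticNonvanishing.chromaticL_ne_zero (h : SprungChromaticNonvanishing)
    {W : WeierstrassCurve ℚ} [W.IsElliptic] [W.IsGloballyMinimal] {p : ℕ} [Fact p.Prime]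
    (hp2 : p ≠ 2) (hG : GoodSS W p) {N : ℕ} [NeZero N] {f : CuspForm (Gamma0 N) 2}
    (hf : IsNewformOf W f) {Lsharp Lflat : IwasawaAlgebra p}
    (hSP : IsSprungPair f p (W.frobeniusTrace p) Lsharp Lflat) (c : Chroma) :
    chromaticL c Lsharp Lflat ≠ 0 := by
  obtain ⟨h1, h2⟩ := h W p hp2 hG N f hf Lsharp Lflat hSP
  cases c with
  | sharp => rwa [chromaticL_sharp]
  | flat => rwa [chromaticL_flat]

/-- **On class X8** (`p = 3`, good supersingular, `a_3 = ±3`), any analytic rank: granted the node,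
`L♯ ≠ 0 ∧ L♭ ≠ 0` for every Sprung pair of the newform of `E`. (Unconditional in analytic rank `0`:
`ClassX8.sharp_ne_zero_and_flat_ne_zero_of_analyticRank_eq_zero`.)
[cite: Sprung2012, Conj. 6.15 (p. 1498)] -/
theorem SprungChromaticNonvanishing.classX8 (h : SprungChromaticNonvanishing)
    {W : WeierstrassCurve ℚ} [W.IsElliptic] [W.IsGloballyMinimal] {p : ℕ} [Fact p.Prime]
    (hX : ClassX8 W p) {N : ℕ} [NeZero N] {f : CuspForm (Gamma0 N) 2} (hf : IsNewformOf W f)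
    {Lsharp Lflat : IwasawaAlgebra p} (hSP : IsSprungPair f p (W.frobeniusTrace p) Lsharp Lflat) :
    Lsharp ≠ 0 ∧ Lflat ≠ 0 := by
  obtain ⟨hp3, hG, -⟩ := hX
  subst hp3
  exact h W 3 (by decide) hG N f hf Lsharp Lflat hSP

/-- **With Sprung's existence theorem**: granted the node, at an odd good supersingular prime the
newform of `E` HAS a Sprung pair with both members non-zero (existence = Sprung 2017 Thm. 1.12,
PROVED in the tree as `thm112_exists_isSprungPair_holds`). [cite: Sprung2017, Thm. 1.12]
[cite: Sprung2012, Conj. 6.15 (p. 1498)] -/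
theorem SprungChromaticNonvanishing.exists_pair_both_ne_zero (h : SprungChromaticNonvanishing)
    {W : WeierstrassCurve ℚ} [W.IsElliptic] [W.IsGloballyMinimal] {p : ℕ} [Fact p.Prime]
    (hp2 : p ≠ 2) (hG : GoodSS W p) {N : ℕ} [NeZero N] {f : CuspForm (Gamma0 N) 2}
    (hf : IsNewformOf W f) :
    ∃ Lsharp Lflat : IwasawaAlgebra p,
      IsSprungPair f p (W.frobeniusTrace p) Lsharp Lflat ∧ Lsharp ≠ 0 ∧ Lflat ≠ 0 := by
  obtain ⟨Lsharp, Lflat, hSP⟩ :=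
    thm112_exists_isSprungPair_holds (W := W) (f := f) (p := p) hp2 hf hG.1 hG.2
  exact ⟨Lsharp, Lflat, hSP, h W p hp2 hG N f hf Lsharp Lflat hSP⟩

end Summit.BirchSwinnertonDyer.Rank1Residual.Supersingular

end
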